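import Literature.NumberTheory.LFunctions.Zhang2022.KnifeEdgeLenZDegreeEndgame

/-!
# Zhang (2022), rung F-S3 (Landau–Siegel programme, §D edge len = E*-len⁺): card `z-degree-toeplitz-band` with the
# degree-2 table DARK (`X₂ = 0`, the critic's A0 census) — the TRIDIAGONAL main matrix, its SCHUR closing criterion,
# the Schur bound (barrier side) and the kernel-pair corollary (all PROVED; nothing asserted)

Y. Zhang, *Discrete mean estimates and the Landau–Siegel zero*, arXiv:2211.02515v1 [Zhang2022LandauSiegel] —
an unrefereed manuscript under adjudication. **WHAT THIS IS NOT: not a claim about Theorems 1–2 of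
arXiv:2211.02515, about Landau–Siegel zeros, or about Parity. The programme SEARCHES and TYPES; no claim about
Landau–Siegel zeros, Theorems 1–2 of arXiv:2211.02515 or a repaired Margin232 until a kernel theorem says so.
Every `theorem` below is finite algebra about the main-term matrix `gradedMainMatrix X₁ Y₁ 0` of `KnifeEdgeLenZDegree`
or an implication into its closing alternative `GradedCloses X₁ Y₁ 0` (a bare `Prop`); nothing is asserted.**

CONTEXT (cell landau-siegel §D; critic ls-knife-crit-1 g2, A0 re-run 2026-08-27T01:11:22Z + addendum 01:22:21Z; tribunal
desk frontier-trib-ls-1 g5 probe ZDegreeJunk.lean 0fda36fc1752bacd, 01:22:36Z). On Zhang's `χψ`-twisted data the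
`d = ±2` table has an EMPTY exact diagonal (`m n a ≡ D² l₁l₂l₃`, `(mn, D) = 1 ⇒ D² ∣ a ⇒ μ(a) = 0`), so the honest
instance of the degree-2 slot is `X₂ = 0` (`TauTwoTable c' 0`) and the main-term matrix of the graded design is
TRIDIAGONAL `!![𝔅(f), X̄₁, 0; X₁, 𝔅(g₁), Ȳ₁; 0, Y₁, 𝔅(g₂)]`, with the degree-1 DUAL table `Y₁ = DualCrossTable c' 1`
(conj-poly × poly; exact class NON-empty per the critic's census) the live entry. This file proves the critic's R1(b)
reading as kernel facts:
* `gradedQuadForm_dark` — the tridiagonal quadratic form in closed form;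
* **`gradedCloses_dark_of_schur`** — SCHUR CLOSING CRITERION: for in-class `f, g₁, g₂` with `𝔅(f), 𝔅(g₂) > 0`,
  `|X₁(f,g₁)|²/𝔅(f) + |Y₁(g₁,g₂)|²/𝔅(g₂) > 𝔅(g₁) ⇒ GradedCloses X₁ Y₁ 0` (two degree-1 correlations of the middle vector
  summing past its mass; each `2×2` block may be PSD while the `3×3` is not);
* `gradedQuadForm_dark_nonneg_of_schur` — the converse reading per triple (Schur bound ⇒ form `≥ 0`: the barrier side,
  B-AH⁺; in an AFE/moment-sequence model a kernel pair forces `Y₁(g₁,·) = 0` and this bound nearby);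
* **`gradedCloses_dark_of_kernelPair`** — at a KERNEL PAIR (`𝔅(f)𝔅(g₁) = |X₁(f,g₁)|²`, `𝔅(f) ≠ 0`) ANY `g₂` with
  `Y₁(g₁,g₂) ≠ 0` closes (the desk's ZD3, = `gradedCloses_of_forcing_violated` at `X₂ = 0`).
With `KnifeEdgeLenZDegreeEndgame.theorem1_of_gradedCloses` (slots `InClassMean`, `CrossTable c' 1 X₁`,
`DualCrossTable c' 1 Y₁`, `TauTwoTable c' 0` + `Prop22i`, `Lemma23`) any such closing gives Theorem 1 — the deliverable
the critic names is the recipe value of `Y₁(g₁, g₂)` for (near-)kernel partners `g₁` of some `f`.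

Typer: ls-knife-typer-1 (cell landau-siegel §D).

## References
* Y. Zhang, arXiv:2211.02515v1 (2022), §2 (2.16)–(2.17), (2.32); §7 Prop 7.1 (7.2); §8 (8.5).
  [cite: Zhang2022LandauSiegel, §2 (2.16), §7 Prop 7.1, §8 (8.5)]
-/

noncomputable section

open Complex Real ComplexConjugate Matrix
open scoped ComplexOrder

namespace Literature.NumberTheory.LFunctions.Zhang2022.KnifeEdge

open Repair Skeleton

/-! ### `X₂ = 0`: the tridiagonal form, the Schur closing criterion, the Schur bound, the kernel-pair corollary -/

section Dark

variable {X₁ Y₁ : PairFunctional} {f f' g₁ g₁' g₂ g₂' : ℝ → ℂ}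

/-- With `X₂ = 0` the graded quadratic form is the TRIDIAGONAL form
`𝔅(f)|s₀|² + 𝔅(g₁)|s₁|² + 𝔅(g₂)|s₂|² + 2Re(s₀·conj(s₁X₁)) + 2Re(s₁·conj(s₂Y₁))` (pure algebra). The critic's A0
census (exact diagonal of the `d = ±2` pattern EMPTY on `pc = χψ` data: `(mn,D) = 1 ⇒ D² ∣ a ⇒ μ(a) = 0`) predicts
exactly this instance `X₂ = 0` of `TauTwoTable`. [cite: Zhang2022LandauSiegel, §2 (2.16), §8 (8.5)] -/
theorem gradedQuadForm_dark (X₁ Y₁ : PairFunctional) (f f' g₁ g₁' g₂ g₂' : ℝ → ℂ) (s : Fin 3 → ℂ) :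
    gradedQuadForm (gradedMainMatrix X₁ Y₁ 0 f f' g₁ g₁' g₂ g₂') s =
      mainTermForm f f' * ‖s 0‖ ^ 2 + mainTermForm g₁ g₁' * ‖s 1‖ ^ 2 + mainTermForm g₂ g₂' * ‖s 2‖ ^ 2
        + 2 * (s 0 * conj (s 1 * X₁ f f' g₁ g₁')).re + 2 * (s 1 * conj (s 2 * Y₁ g₁ g₁' g₂ g₂')).re := by
  simp only [gradedQuadForm, gradedMainMatrix, Fin.sum_univ_three, Matrix.of_apply, Matrix.cons_val',
    Matrix.cons_val_zero, Matrix.cons_val_one, Matrix.cons_val_two, Matrix.empty_val', Matrix.cons_val_fin_one,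
    Matrix.head_cons, Matrix.tail_cons, Matrix.head_fin_const]
  have h0 : ∀ z : ℂ, (z * conj z).re = ‖z‖ ^ 2 := fun z => by rw [Complex.mul_conj']; norm_cast
  have h1 : ∀ (z w : ℂ) (r : ℝ), (z * conj w * (r : ℂ)).re = r * (z * conj w).re := fun z w r => by
    rw [Complex.mul_re, Complex.ofReal_re, Complex.ofReal_im]; ring
  have h2 : ∀ z w u : ℂ, (z * conj w * conj u).re + (w * conj z * u).re = 2 * (z * conj (w * u)).re := by
    intro z w u
    have : w * conj z * u = conj (z * conj w * conj u) := by
      rw [map_mul, map_mul, Complex.conj_conj, Complex.conj_conj]; ring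
    rw [this, Complex.conj_re, map_mul]; ring
  simp only [Pi.zero_apply, map_zero, mul_zero, add_zero, zero_add, Complex.add_re, h1, h0]
  have e1 := h2 (s 0) (s 1) (X₁ f f' g₁ g₁')
  have e2 := h2 (s 1) (s 2) (Y₁ g₁ g₁' g₂ g₂')
  linarith [e1, e2]

/-- completing a square: `2Re(z·conj w) ≥ −(t|z|² + |w|²/t)` for `t > 0` (pure algebra). [folklore] -/
private theorem two_re_mul_conj_ge (z w : ℂ) {t : ℝ} (ht : 0 < t) :
    -(t * ‖z‖ ^ 2 + ‖w‖ ^ 2 / t) ≤ 2 * (z * conj w).re := by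
  have h := Complex.normSq_nonneg ((t : ℂ) * z + w)
  rw [Complex.normSq_add, Complex.normSq_eq_norm_sq, Complex.normSq_eq_norm_sq, norm_mul, Complex.norm_real,
    Real.norm_of_nonneg ht.le] at h
  have hre : ((t : ℂ) * z * conj w).re = t * (z * conj w).re := by
    rw [mul_assoc, Complex.re_ofReal_mul]
  rw [hre] at h
  have ht' : t ≠ 0 := ht.ne'
  have key : t * ‖z‖ ^ 2 + ‖w‖ ^ 2 / t + 2 * (z * conj w).re =
      ((t * ‖z‖) ^ 2 + ‖w‖ ^ 2 + 2 * (t * (z * conj w).re)) / t := by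
    field_simp
  have : 0 ≤ ((t * ‖z‖) ^ 2 + ‖w‖ ^ 2 + 2 * (t * (z * conj w).re)) / t := div_nonneg h ht.le
  linarith

/-- **SCHUR CLOSING CRITERION at `X₂ = 0` (proved; the critic's R1(b) test):** for in-class `f, g₁, g₂` with
`𝔅(f), 𝔅(g₂) > 0`, if the two degree-1 correlations of the middle vector `Z·conj Q_{g₁}` sum past its mass —
`|X₁(f,g₁)|²/𝔅(f) + |Y₁(g₁,g₂)|²/𝔅(g₂) > 𝔅(g₁)` — then `GradedCloses X₁ Y₁ 0` (witness amplitudes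
`(−X₁/𝔅(f), 1, −conj Y₁/𝔅(g₂))`). Each `2×2` block may be PSD while the tridiagonal `3×3` is not.
[cite: Zhang2022LandauSiegel, §2 (2.16), §7 Prop 7.1 (7.2)] -/
theorem gradedCloses_dark_of_schur (hf : InClassPiece f f') (hg₁ : InClassPiece g₁ g₁') (hg₂ : InClassPiece g₂ g₂')
    (hB0 : 0 < mainTermForm f f') (hB2 : 0 < mainTermForm g₂ g₂')
    (hlt : mainTermForm g₁ g₁' < ‖X₁ f f' g₁ g₁'‖ ^ 2 / mainTermForm f f' + ‖Y₁ g₁ g₁' g₂ g₂'‖ ^ 2 / mainTermForm g₂ g₂') :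
    GradedCloses X₁ Y₁ 0 := by
  set B0 := mainTermForm f f' with hB0_def
  set B2 := mainTermForm g₂ g₂' with hB2_def
  set X := X₁ f f' g₁ g₁' with hX_def
  set Y := Y₁ g₁ g₁' g₂ g₂' with hY_def
  refine ⟨f, f', g₁, g₁', g₂, g₂', ![-X / (B0 : ℂ), 1, -conj Y / (B2 : ℂ)], hf, hg₁, hg₂, ?_⟩
  rw [gradedQuadForm_dark]
  simp only [Matrix.cons_val_zero, Matrix.cons_val_one, Matrix.head_cons, Matrix.cons_val_two, Matrix.tail_cons,
    one_mul, norm_one, one_pow, mul_one]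
  have hB0' : (B0 : ℂ) ≠ 0 := by exact_mod_cast hB0.ne'
  have hB2' : (B2 : ℂ) ≠ 0 := by exact_mod_cast hB2.ne'
  have n0 : ‖-X / (B0 : ℂ)‖ ^ 2 = ‖X‖ ^ 2 / B0 ^ 2 := by
    rw [norm_div, norm_neg, Complex.norm_real, Real.norm_of_nonneg hB0.le, div_pow]
  have n2 : ‖-conj Y / (B2 : ℂ)‖ ^ 2 = ‖Y‖ ^ 2 / B2 ^ 2 := by
    rw [norm_div, norm_neg, Complex.norm_conj, Complex.norm_real, Real.norm_of_nonneg hB2.le, div_pow]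
  have r0 : (-X / (B0 : ℂ) * conj X).re = -(‖X‖ ^ 2 / B0) := by
    have : -X / (B0 : ℂ) * conj X = (((-(‖X‖ ^ 2 / B0)) : ℝ) : ℂ) := by
      push_cast
      rw [← Complex.mul_conj']
      field_simp
    rw [this, Complex.ofReal_re]
  have r2 : (conj (-conj Y / (B2 : ℂ) * Y)).re = -(‖Y‖ ^ 2 / B2) := by
    rw [Complex.conj_re]
    have : -conj Y / (B2 : ℂ) * Y = (((-(‖Y‖ ^ 2 / B2)) : ℝ) : ℂ) := by
      push_cast
      rw [← Complex.mul_conj']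
      field_simp
    rw [this, Complex.ofReal_re]
  rw [n0, n2, r0, r2]
  have e0 : B0 * (‖X‖ ^ 2 / B0 ^ 2) = ‖X‖ ^ 2 / B0 := by field_simp
  have e2 : B2 * (‖Y‖ ^ 2 / B2 ^ 2) = ‖Y‖ ^ 2 / B2 := by field_simp
  rw [e0, e2]
  linarith

/-- **SCHUR BOUND ⇒ the triple does not close (proved; the barrier-side reading B-AH⁺ at `X₂ = 0`):** if
`𝔅(f), 𝔅(g₂) > 0` and `|X₁(f,g₁)|²/𝔅(f) + |Y₁(g₁,g₂)|²/𝔅(g₂) ≤ 𝔅(g₁)`, the tridiagonal form is `≥ 0` on every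
amplitude vector (completing two squares). In an AFE/moment-sequence model a kernel pair forces `Y₁(g₁,·) = 0` and this
bound near it (critic 01:22:21Z (4)); a recipe value of `Y₁` violating it is the contradiction branch.
[cite: Zhang2022LandauSiegel, §2 (2.16), §7 Prop 7.1 (7.2)] -/
theorem gradedQuadForm_dark_nonneg_of_schur (hB0 : 0 < mainTermForm f f') (hB2 : 0 < mainTermForm g₂ g₂')
    (hS : ‖X₁ f f' g₁ g₁'‖ ^ 2 / mainTermForm f f' + ‖Y₁ g₁ g₁' g₂ g₂'‖ ^ 2 / mainTermForm g₂ g₂' ≤ mainTermForm g₁ g₁')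
    (s : Fin 3 → ℂ) : 0 ≤ gradedQuadForm (gradedMainMatrix X₁ Y₁ 0 f f' g₁ g₁' g₂ g₂') s := by
  rw [gradedQuadForm_dark]
  have h1 := two_re_mul_conj_ge (s 0) (s 1 * X₁ f f' g₁ g₁') hB0
  have h2 := two_re_mul_conj_ge (s 2) (s 1 * conj (Y₁ g₁ g₁' g₂ g₂')) hB2
  have e2 : (s 2 * conj (s 1 * conj (Y₁ g₁ g₁' g₂ g₂'))).re = (s 1 * conj (s 2 * Y₁ g₁ g₁' g₂ g₂')).re := by
    have hz : s 1 * conj (s 2 * Y₁ g₁ g₁' g₂ g₂') = conj (s 2 * conj (s 1 * conj (Y₁ g₁ g₁' g₂ g₂'))) := by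
      simp only [map_mul, Complex.conj_conj]; ring
    rw [hz, Complex.conj_re]
  rw [e2, norm_mul, Complex.norm_conj, mul_pow] at h2
  rw [norm_mul, mul_pow] at h1
  have hX : ‖s 1‖ ^ 2 * ‖X₁ f f' g₁ g₁'‖ ^ 2 / mainTermForm f f' = ‖s 1‖ ^ 2 * (‖X₁ f f' g₁ g₁'‖ ^ 2 / mainTermForm f f') :=
    mul_div_assoc _ _ _
  have hY : ‖s 1‖ ^ 2 * ‖Y₁ g₁ g₁' g₂ g₂'‖ ^ 2 / mainTermForm g₂ g₂' =
      ‖s 1‖ ^ 2 * (‖Y₁ g₁ g₁' g₂ g₂'‖ ^ 2 / mainTermForm g₂ g₂') := mul_div_assoc _ _ _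
  rw [hX] at h1
  rw [hY] at h2
  nlinarith [mul_nonneg (sq_nonneg ‖s 1‖) (sub_nonneg.2 hS)]

/-- **KERNEL PAIR + NONZERO DUAL TABLE ⇒ CLOSES, at `X₂ = 0` (proved; the tribunal desk's ZD3 in the tree):** for a
kernel pair `(f,g₁)` (`𝔅(f)𝔅(g₁) = |X₁(f,g₁)|²`, `𝔅(f) ≠ 0` — the B-AH/AFE null modes) ANY in-class `g₂` with
`Y₁(g₁,g₂) ≠ 0` closes: the forced identity of `gradedForcing` reads `0 = Y₁·𝔅(f)`. So A0-darkness of `τ₂` relocates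
the card's content to the degree-1 DUAL table `DualCrossTable c' 1 Y₁` on kernel modes (critic's R1(b)).
[cite: Zhang2022LandauSiegel, §2 (2.16), (2.32), §7 Prop 7.1 (7.2)] -/
theorem gradedCloses_dark_of_kernelPair (hf : InClassPiece f f') (hg₁ : InClassPiece g₁ g₁')
    (hg₂ : InClassPiece g₂ g₂')
    (hker : (mainTermForm f f' : ℂ) * (mainTermForm g₁ g₁' : ℂ) = conj (X₁ f f' g₁ g₁') * X₁ f f' g₁ g₁')
    (hB0 : mainTermForm f f' ≠ 0) (hY : Y₁ g₁ g₁' g₂ g₂' ≠ 0) : GradedCloses X₁ Y₁ 0 := by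
  refine gradedCloses_of_forcing_violated hf hg₁ hg₂ hker ?_
  rw [Pi.zero_apply, Pi.zero_apply, Pi.zero_apply, Pi.zero_apply, zero_mul]
  exact (mul_ne_zero hY (by exact_mod_cast hB0)).symm

end Dark

end Literature.NumberTheory.LFunctions.Zhang2022.KnifeEdge

end
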